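import Summits.ValiantsHypothesis.ValiantsHypothesis.Theorems.LacunarySymmetroidMatrixDescartesCensusV19SSoundRows
import Summits.ValiantsHypothesis.ValiantsHypothesis.Theorems.LacunarySymmetroidMatrixDescartesCensusV20SoundFarkas

/-!
# `MatrixDescartes` census — soundness of the 2-SIDON `V = 19` checker: Farkas products, LP certificates, domination competitors

HONEST FRAMING.  Object-search cell `pub-symmetroid`; door-A item `DoorA26 = PosRootLawAt 2 6 19`
(stmt-ValiantsHypothesis-19979; OPEN, typed, never asserted).  Part of the proof that certificates accepted by `V19S.certOK` (`…CensusV19SCheck`)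
exclude a nineteen on a 2-Sidon support (semantics `…CensusV19SModel`): the rows of an accepted list all hold (`…CensusV19SSoundRows`), the
accumulated Farkas product over the `21` positions is `V20.accumulate` with its semantics `V20.accumulate_spec` (`…CensusV20SoundFarkas`), so an
accepted `lp` certificate is contradictory and an accepted domination competitor bounds its positive term by `(un/ud)·|t₀|` (twin of
`…CensusV19CSoundFarkas`).  Nothing here bears on the one-collision supports, on `ζ_sym(2,6)` over all supports, on `DoorA26` itself, on
`MatrixDescartes` (stmt-ValiantsHypothesis-18050) or on `VP ≠ VNP`.

[folklore] Certificate-checker soundness; elementary.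
-/

-- the D-0017 layout repeats a namespace component (single-conjunct summit); the `dupNamespace` linter flags it; name mandated.
set_option linter.dupNamespace false

namespace Summit.ValiantsHypothesis.ValiantsHypothesis.Theorems.LacunarySymmetroidMatrixDescartes.Census.V19S

open V20 (Atom allAtoms psum posOf qA cA Term PolySpec posl oddTrues FNat fval Row rowC25 rowOne rowAmgm FRat negAt bumps mulF divF
  numZ denZ G3poly RCSpoly Wpoly tval pval lprod xpow xpowAux frval BPos lprod_pos atoms_valid coeff_ne_zero qA_mem cA_mem term_getD_mem
  fval_singleton fval_pos xpow_bumps length_bumps xpowAux_replicate_zero frval_nil frval_mulF frval_divF frval_eq_numZ_div_denZ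
  zero21 accumulate accumulate_spec accumulate_eq_foldl)

section Farkas

open Finset

variable {c : Ctx} {x : ℕ → ℝ} {v : Atom → ℝ}

/-- All built rows hold and are well formed. [folklore] -/
theorem buildRows_sound (M : V19S.Model c x v) :
    ∀ (specs : List (RowSpec × ℕ)) (rs : List (Row × ℕ)), buildRows c specs = some rs →
      ∀ rn ∈ rs, Row.Holds x rn.1 ∧ rn.1.WF
  | [], rs, h => by simp [buildRows] at h; subst h; simp
  | (sp, n) :: specs, rs, h => by
    simp only [buildRows] at h
    split at h
    · next r rr hr hrr =>
      cases h
      intro rn hrn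
      simp only [List.mem_cons] at hrn
      rcases hrn with rfl | hrn
      · exact buildRow_sound M hr
      · exact buildRows_sound M specs rr hrr rn hrn
    · cases h

/-- The Farkas product of accepted rows: monomial parts and the constant ratio. [folklore] -/
theorem accumulate_sound (M : V19S.Model c x v) {specs : List (RowSpec × ℕ)} {rs : List (Row × ℕ)}
    (h : buildRows c specs = some rs) :
    (accumulate rs).1.length = 21 ∧ (accumulate rs).2.1.length = 21 ∧ BPos (accumulate rs).2.2 ∧
      ∃ PL PR Cd Cn : ℝ, 0 < PL ∧ 0 < Cn ∧ 0 < Cd ∧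
        xpow x (accumulate rs).1 = PL ∧ xpow x (accumulate rs).2.1 = PR ∧
        frval (accumulate rs).2.2 = Cd / Cn ∧ PL * Cd ≤ PR * Cn := by
  have := accumulate_spec M.xpos rs (buildRows_sound M specs rs h) (zero21, zero21, [])
    (by simp [zero21]) (by simp [zero21]) (by intro bz h; simp at h)
  rw [accumulate_eq_foldl]
  obtain ⟨r1, r2, r3, PL, PR, Cd, Cn, hPL, hCn, hCd, e1, e2, e3, hle⟩ := this
  refine ⟨r1, r2, r3, PL, PR, Cd, Cn, hPL, hCn, hCd, ?_, ?_, ?_, hle⟩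
  · rw [e1, show xpow x (zero21, zero21, ([] : FRat)).1 = 1 from xpowAux_replicate_zero x 21 0, one_mul]
  · rw [e2, show xpow x (zero21, zero21, ([] : FRat)).2.1 = 1 from xpowAux_replicate_zero x 21 0, one_mul]
  · rw [e3, show frval (zero21, zero21, ([] : FRat)).2.2 = 1 from frval_nil, one_mul]

/-! ### LP certificates -/

/-- An accepted Farkas certificate refutes the model. [folklore] -/
theorem lpOK_sound (M : V19S.Model c x v) {specs : List (RowSpec × ℕ)} (h : lpOK c specs = true) : False := by
  unfold lpOK at h
  split at h
  · simp at h
  · next rs hrs =>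
    simp only [Bool.and_eq_true, decide_eq_true_eq] at h
    obtain ⟨hbal, hlt⟩ := h
    obtain ⟨-, -, hB, PL, PR, Cd, Cn, hPL, hCn, hCd, e1, e2, e3, hle⟩ := accumulate_sound M hrs
    have hPLR : PL = PR := by rw [← e1, ← e2, hbal]
    have hratio : Cd ≤ Cn := le_of_mul_le_mul_left (a := PL) (by rw [hPLR] at hle ⊢; exact hle) hPL
    obtain ⟨hf, hden⟩ := frval_eq_numZ_div_denZ hB
    rw [e3] at hf
    have hdenR : (0 : ℝ) < denZ (accumulate rs).2.2 := by exact_mod_cast hden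
    have h1 : Cd / Cn ≤ 1 := (div_le_one hCn).2 hratio
    rw [hf] at h1
    have h2 : (numZ (accumulate rs).2.2 : ℝ) ≤ denZ (accumulate rs).2.2 := by
      rwa [div_le_one hdenR] at h1
    have h3 : numZ (accumulate rs).2.2 ≤ denZ (accumulate rs).2.2 := by exact_mod_cast h2
    omega

/-! ### Domination certificates: one competitor -/

/-- One competitor: the bound `|t_k| · ud ≤ un · |t₀|` (terms `k`, `n0` without the zero atom). [folklore] -/
theorem compOK_sound (M : V19S.Model c x v) {P : PolySpec} (hval : P.valid = true) {n0 ud : ℕ}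
    (hn0 : n0 < P.poly.length) (hz0 : termZero c (P.poly.getD n0 (0, [])) = false) (hud : 0 < ud) {cp : Comp}
    (hk : cp.k < P.poly.length) (hzk : termZero c (P.poly.getD cp.k (0, [])) = false)
    (h : compOK c P.poly n0 ud cp = true) :
    |tval v (P.poly.getD cp.k (0, []))| * ud ≤ cp.un * |tval v (P.poly.getD n0 (0, []))| := by
  unfold compOK at h
  split at h
  · simp at h
  · next rs hrs =>
    simp only [Bool.and_eq_true, decide_eq_true_eq] at h
    obtain ⟨⟨⟨hD, hun⟩, hbal⟩, hle⟩ := h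
    obtain ⟨hl1, hl2, hB, PL, PR, Cd, Cn, hPL, hCn, hCd, e1, e2, e3, hrow⟩ := accumulate_sound M hrs
    have hT0a := atoms_valid P hval _ (term_getD_mem P.poly hn0)
    have hTka := atoms_valid P hval _ (term_getD_mem P.poly hk)
    have hg0 : (P.poly.getD n0 (0, [])).1 ≠ 0 := coeff_ne_zero P _ (term_getD_mem P.poly hn0)
    have hgk : (P.poly.getD cp.k (0, [])).1 ≠ 0 := coeff_ne_zero P _ (term_getD_mem P.poly hk)
    rw [abs_tval_eq M _ hT0a hz0, abs_tval_eq M _ hTka hzk]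
    set G0 : ℝ := |((P.poly.getD n0 (0, [])).1 : ℝ)| with hG0
    set Gk : ℝ := |((P.poly.getD cp.k (0, [])).1 : ℝ)| with hGk
    set m0 := lprod x (posl c.ord (P.poly.getD n0 (0, [])).2) with hm0
    set mk := lprod x (posl c.ord (P.poly.getD cp.k (0, [])).2) with hmk
    have hm0p : 0 < m0 := lprod_pos M.xpos _
    have hmkp : 0 < mk := lprod_pos M.xpos _
    have hG0p : 0 < G0 := by rw [hG0]; exact abs_pos.2 (by exact_mod_cast hg0)
    have hGkp : 0 < Gk := by rw [hGk]; exact abs_pos.2 (by exact_mod_cast hgk)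
    have hudR : (0 : ℝ) < ud := by exact_mod_cast hud
    have hunR : (0 : ℝ) < cp.un := by exact_mod_cast hun
    have hbal' : PL * m0 ^ cp.D = PR * mk ^ cp.D := by
      have h1 := xpow_bumps x (accumulate rs).1 (posl c.ord (P.poly.getD n0 (0, [])).2) cp.D
        (fun p hp => by rw [hl1]; exact posl_lt_21 M hT0a p hp)
      have h2 := xpow_bumps x (accumulate rs).2.1 (posl c.ord (P.poly.getD cp.k (0, [])).2) cp.D
        (fun p hp => by rw [hl2]; exact posl_lt_21 M hTka p hp)
      rw [← e1, ← e2, ← h1, ← h2, hbal]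
    have hb1 : ∀ be ∈ [(cp.un * (P.poly.getD n0 (0, [])).1.natAbs, cp.D)], 0 < be.1 := by
      intro be hbe; simp only [List.mem_singleton] at hbe; subst hbe
      exact Nat.mul_pos hun (Int.natAbs_pos.2 hg0)
    have hb2 : ∀ be ∈ [((P.poly.getD cp.k (0, [])).1.natAbs * ud, cp.D)], 0 < be.1 := by
      intro be hbe; simp only [List.mem_singleton] at hbe; subst hbe
      exact Nat.mul_pos (Int.natAbs_pos.2 hgk) hud
    have hm := frval_mulF hb1 1 hB
    have hd := frval_divF hb2 1 hm.2
    obtain ⟨hf, hden⟩ := frval_eq_numZ_div_denZ hd.2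
    have hdenR : (0 : ℝ) < denZ (divF (mulF (accumulate rs).2.2 [(cp.un * (P.poly.getD n0 (0, [])).1.natAbs, cp.D)] 1)
        [((P.poly.getD cp.k (0, [])).1.natAbs * ud, cp.D)] 1) := by exact_mod_cast hden
    have hge : (1 : ℝ) ≤ frval (divF (mulF (accumulate rs).2.2 [(cp.un * (P.poly.getD n0 (0, [])).1.natAbs, cp.D)] 1)
        [((P.poly.getD cp.k (0, [])).1.natAbs * ud, cp.D)] 1) := by
      rw [hf, le_div_iff₀ hdenR, one_mul]; exact_mod_cast hle
    rw [hd.1, hm.1, e3, fval_singleton, fval_singleton, pow_one, pow_one] at hge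
    push_cast at hge
    rw [Nat.cast_natAbs, Int.cast_abs, Nat.cast_natAbs, Int.cast_abs] at hge
    have hX : 0 < (Gk * ud) ^ cp.D := by positivity
    have hi : Cn * (Gk * ud) ^ cp.D ≤ Cd * (cp.un * G0) ^ cp.D := by
      have := hge
      rw [le_div_iff₀ hX, one_mul, div_mul_eq_mul_div, le_div_iff₀ hCn] at this
      linarith
    have hii : PL * (Gk * ud) ^ cp.D ≤ PR * (cp.un * G0) ^ cp.D := by
      have h1 : PL * (Cn * (Gk * ud) ^ cp.D) ≤ PL * (Cd * (cp.un * G0) ^ cp.D) := mul_le_mul_of_nonneg_left hi hPL.le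
      have h2 : PL * Cd * (cp.un * G0) ^ cp.D ≤ PR * Cn * (cp.un * G0) ^ cp.D :=
        mul_le_mul_of_nonneg_right hrow (by positivity)
      nlinarith
    have hiii : (mk * Gk * ud) ^ cp.D ≤ (m0 * cp.un * G0) ^ cp.D := by
      have h1 : PL * mk ^ cp.D * (Gk * ud) ^ cp.D ≤ PR * mk ^ cp.D * (cp.un * G0) ^ cp.D := by
        nlinarith [pow_pos hmkp cp.D]
      rw [show PR * mk ^ cp.D = PL * m0 ^ cp.D from hbal'.symm] at h1
      have h1' : PL * (mk ^ cp.D * (Gk * ud) ^ cp.D) ≤ PL * (m0 ^ cp.D * (cp.un * G0) ^ cp.D) := by linarith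
      have h2 : mk ^ cp.D * (Gk * ud) ^ cp.D ≤ m0 ^ cp.D * (cp.un * G0) ^ cp.D := le_of_mul_le_mul_left h1' hPL
      simp only [mul_pow] at h2 ⊢
      linarith
    have hfin : mk * Gk * ud ≤ m0 * cp.un * G0 :=
      (pow_le_pow_iff_left₀ (by positivity) (by positivity) (by omega)).1 hiii
    nlinarith

end Farkas

end Summit.ValiantsHypothesis.ValiantsHypothesis.Theorems.LacunarySymmetroidMatrixDescartes.Census.V19S
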